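import Summits.Ventures.PercRepro.RLSRuleKFourSupply

/-!
# C-025 at q = 3: the `K₄`-plane — the demands and the exact-share accounting at `p = 8`, `t = 2` (night-3, gen 4)

* demands: `≤ 38` at `t = 0` (every rank-`3` subset), `≤ 37` at `t = 1`, `≤ 31` at `t = 2`, `≤ 12` at `t = 3` (an
  independent triple with an independent complement: the four complements of lines are excluded);
* **`kFour_supply_exact`** — with no loss, the EXACT shares `ρ₃(B′)/(C(b + x, 3) − #lines in B′)` for the `𝒯₀`
  subsets (mine-4 4785: at `t = 2`, `p = 8` the crude form is `1.7 %` short; the exact denominators are the landed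
  census cell `Cells.k4_t2_p8`).
Imports `RLSRuleKFourSupply`.  Axioms: standard.
-/

open scoped Matroid

namespace PercRepro

namespace NightThree

open Finset ThmH PerFlat

variable {α : Type*} [DecidableEq α] {M : Matroid α} [M.Finite]

open scoped Classical in
/-- The bottom sets of a `K₄`-plane are rank-`3` subsets: at most `38` of them. -/
theorem card_UqG_le_kFour_t0 {G : Finset α} {L : Finset (Finset α)} {p : ℕ} (h : KFour M G L) :
    (UqG M p 3 G).card ≤ 38 := by
  obtain ⟨hGc, hLc, hL, hdeg, hind⟩ := h
  have hsub : UqG M p 3 G ⊆ (G.powersetCard 3).filter (fun T => T ∉ L) ∪ G.powersetCard 4 ∪ G.powersetCard 5 ∪ {G} := by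
    intro B hB
    have hB' := hB
    unfold UqG at hB'
    rw [Finset.mem_filter, mem_Uq] at hB'
    obtain ⟨⟨_, hB3, _⟩, hBG⟩ := hB'
    have hB3' : M.eRk (B : Set α) = 3 := by exact_mod_cast hB3
    have hBc := three_le_card_of_eRk_eq_three hB3'
    have hB6 : B.card ≤ 6 := by rw [← hGc]; exact Finset.card_le_card hBG
    simp only [Finset.mem_union, Finset.mem_filter, Finset.mem_powersetCard, Finset.mem_singleton]
    rcases (show B.card = 3 ∨ B.card = 4 ∨ B.card = 5 ∨ B.card = 6 by omega) with h3 | h4 | h5 | h6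
    · left; left; left
      refine ⟨⟨hBG, h3⟩, ?_⟩
      intro hBL
      have := (hL B hBL).2.2
      rw [this] at hB3'
      exact absurd hB3' (by decide)
    · left; left; right; exact ⟨hBG, h4⟩
    · left; right; exact ⟨hBG, h5⟩
    · right; exact Finset.eq_of_subset_of_card_le hBG (by omega)
  have hsubL : L ⊆ G.powersetCard 3 := fun ℓ hℓ => Finset.mem_powersetCard.2 ⟨(hL ℓ hℓ).1, (hL ℓ hℓ).2.1⟩
  have hc3 : ((G.powersetCard 3).filter (fun T => T ∉ L)).card = 16 := by
    have := Finset.card_filter_add_card_filter_not (s := G.powersetCard 3) (fun T => T ∉ L)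
    have hL' : (G.powersetCard 3).filter (fun T => ¬ T ∉ L) = L := by
      ext T; simp only [Finset.mem_filter, not_not]; exact ⟨fun h => h.2, fun h => ⟨hsubL h, h⟩⟩
    rw [hL', hLc, Finset.card_powersetCard, hGc, show Nat.choose 6 3 = 20 by norm_num [Nat.choose]] at this
    omega
  calc (UqG M p 3 G).card ≤ _ := Finset.card_le_card hsub
    _ ≤ ((G.powersetCard 3).filter (fun T => T ∉ L) ∪ G.powersetCard 4 ∪ G.powersetCard 5).card + 1 := by
        have := Finset.card_union_le ((G.powersetCard 3).filter (fun T => T ∉ L) ∪ G.powersetCard 4 ∪ G.powersetCard 5) {G}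
        rw [Finset.card_singleton] at this; exact this
    _ ≤ ((G.powersetCard 3).filter (fun T => T ∉ L) ∪ G.powersetCard 4).card + (G.powersetCard 5).card + 1 := by
        have := Finset.card_union_le ((G.powersetCard 3).filter (fun T => T ∉ L) ∪ G.powersetCard 4) (G.powersetCard 5)
        omega
    _ ≤ ((G.powersetCard 3).filter (fun T => T ∉ L)).card + (G.powersetCard 4).card + (G.powersetCard 5).card + 1 := by
        have := Finset.card_union_le ((G.powersetCard 3).filter (fun T => T ∉ L)) (G.powersetCard 4)
        omega
    _ = 38 := by rw [hc3, Finset.card_powersetCard, Finset.card_powersetCard, hGc]; rfl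

open scoped Classical in
/-- At `t ≥ 1` the bottom sets miss `t` points; the common part of the demand bounds. -/
theorem card_UqG_le_kFour_of_le {G : Finset α} {L : Finset (Finset α)} {n t e : ℕ} (h : KFour M G L)
    (he : M.eRk ((gr M \ G : Finset α) : Set α) = e) (het : e + t ≤ n + 4) :
    (UqG M (n + 4) 3 G).card ≤
      ((G.powersetCard 3).filter (fun T => T ∉ L) ∪ (G.powerset.filter (fun B => 4 ≤ B.card ∧ B.card + t ≤ 6))).card := by
  obtain ⟨hGc, hLc, hL, hdeg, hind⟩ := h
  apply Finset.card_le_card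
  intro B hB
  have hle := card_add_le_of_mem_UqG hB he het
  have hB' := hB
  unfold UqG at hB'
  rw [Finset.mem_filter, mem_Uq] at hB'
  obtain ⟨⟨_, hB3, _⟩, hBG⟩ := hB'
  have hB3' : M.eRk (B : Set α) = 3 := by exact_mod_cast hB3
  have hBc := three_le_card_of_eRk_eq_three hB3'
  simp only [Finset.mem_union, Finset.mem_filter, Finset.mem_powersetCard, Finset.mem_powerset]
  rcases Nat.lt_or_ge B.card 4 with h3 | h4
  · left
    refine ⟨⟨hBG, by omega⟩, ?_⟩
    intro hBL
    have := (hL B hBL).2.2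
    rw [this] at hB3'
    exact absurd hB3' (by decide)
  · right; exact ⟨hBG, h4, by omega⟩

omit [DecidableEq α] [M.Finite] in
/-- `#{B ⊆ G : 4 ≤ |B| ∧ |B| + 1 ≤ 6} = 21` for `|G| = 6`. -/
theorem card_filter_four_le_one {G : Finset α} (hGc : G.card = 6) :
    (G.powerset.filter (fun B => 4 ≤ B.card ∧ B.card + 1 ≤ 6)).card = 21 := by
  classical
  have h := Finset.card_filter (fun B : Finset α => 4 ≤ B.card ∧ B.card + 1 ≤ 6) G.powerset
  rw [h, Finset.sum_powerset_apply_card (fun b => if 4 ≤ b ∧ b + 1 ≤ 6 then 1 else 0), hGc]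
  norm_num [Finset.sum_range_succ, Nat.choose]

omit [DecidableEq α] [M.Finite] in
/-- `#{B ⊆ G : 4 ≤ |B| ∧ |B| + 2 ≤ 6} = 15` for `|G| = 6`. -/
theorem card_filter_four_le_two {G : Finset α} (hGc : G.card = 6) :
    (G.powerset.filter (fun B => 4 ≤ B.card ∧ B.card + 2 ≤ 6)).card = 15 := by
  classical
  have h := Finset.card_filter (fun B : Finset α => 4 ≤ B.card ∧ B.card + 2 ≤ 6) G.powerset
  rw [h, Finset.sum_powerset_apply_card (fun b => if 4 ≤ b ∧ b + 2 ≤ 6 then 1 else 0), hGc]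
  norm_num [Finset.sum_range_succ, Nat.choose]

open scoped Classical in
omit [M.Finite] in
/-- `#{independent triples of a K₄-plane} = 16`. -/
theorem card_indep_triples_kFour {G : Finset α} {L : Finset (Finset α)} (h : KFour M G L) :
    ((G.powersetCard 3).filter (fun T => T ∉ L)).card = 16 := by
  obtain ⟨hGc, hLc, hL, hdeg, hind⟩ := h
  have hsubL : L ⊆ G.powersetCard 3 := fun ℓ hℓ => Finset.mem_powersetCard.2 ⟨(hL ℓ hℓ).1, (hL ℓ hℓ).2.1⟩
  have := Finset.card_filter_add_card_filter_not (s := G.powersetCard 3) (fun T => T ∉ L)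
  have hL' : (G.powersetCard 3).filter (fun T => ¬ T ∉ L) = L := by
    ext T; simp only [Finset.mem_filter, not_not]; exact ⟨fun h => h.2, fun h => ⟨hsubL h, h⟩⟩
  rw [hL', hLc, Finset.card_powersetCard, hGc, show Nat.choose 6 3 = 20 by norm_num [Nat.choose]] at this
  omega

open scoped Classical in
/-- Demand at `t = 1`: `≤ 37`. -/
theorem card_UqG_le_kFour_t1 {G : Finset α} {L : Finset (Finset α)} {n : ℕ} (h : KFour M G L)
    (hK : M.eRk ((gr M \ G : Finset α) : Set α) = ((n + 3 : ℕ) : ℕ∞)) : (UqG M (n + 4) 3 G).card ≤ 37 := by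
  have h1 := card_UqG_le_kFour_of_le h hK (n := n) (t := 1) (e := n + 3) (by omega)
  have h2 := Finset.card_union_le ((G.powersetCard 3).filter (fun T => T ∉ L))
    (G.powerset.filter (fun B => 4 ≤ B.card ∧ B.card + 1 ≤ 6))
  rw [card_indep_triples_kFour h, card_filter_four_le_one h.1] at h2
  omega

open scoped Classical in
/-- Demand at `t = 2`: `≤ 31`. -/
theorem card_UqG_le_kFour_t2 {G : Finset α} {L : Finset (Finset α)} {n : ℕ} (h : KFour M G L)
    (hK : M.eRk ((gr M \ G : Finset α) : Set α) = ((n + 2 : ℕ) : ℕ∞)) : (UqG M (n + 4) 3 G).card ≤ 31 := by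
  have h1 := card_UqG_le_kFour_of_le h hK (n := n) (t := 2) (e := n + 2) (by omega)
  have h2 := Finset.card_union_le ((G.powersetCard 3).filter (fun T => T ∉ L))
    (G.powerset.filter (fun B => 4 ≤ B.card ∧ B.card + 2 ≤ 6))
  rw [card_indep_triples_kFour h, card_filter_four_le_two h.1] at h2
  omega

open scoped Classical in
/-- Demand at `t = 3`: `≤ 12` — the independent triples whose complement is not a line (the map `ℓ ↦ G ∖ ℓ` sends the
four lines to four distinct independent triples). -/
theorem card_UqG_le_kFour_t3 {p : ℕ} (hc : Core M p) {G : Finset α} {L : Finset (Finset α)} {n : ℕ}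
    (hG : G ∈ flatsQ M 3) (h : KFour M G L) (hK : M.eRk ((gr M \ G : Finset α) : Set α) = ((n + 1 : ℕ) : ℕ∞)) :
    (UqG M (n + 4) 3 G).card ≤ 12 := by
  have h' := h
  obtain ⟨hGc, hLc, hL, hdeg, hind⟩ := h
  have hsub : UqG M (n + 4) 3 G ⊆ ((G.powersetCard 3).filter (fun T => T ∉ L)) \ (L.image (fun ℓ => G \ ℓ)) := by
    intro B hB
    have hle := card_add_le_of_mem_UqG hB hK (by omega : n + 1 + 3 ≤ n + 4)
    have hge := eRk_sdiff_ge_of_mem_UqG hB hK (by omega : n + 1 + 3 ≤ n + 4)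
    have hB' := hB
    unfold UqG at hB'
    rw [Finset.mem_filter, mem_Uq] at hB'
    obtain ⟨⟨_, hB3, _⟩, hBG⟩ := hB'
    have hB3' : M.eRk (B : Set α) = 3 := by exact_mod_cast hB3
    have hBc := three_le_card_of_eRk_eq_three hB3'
    rw [Finset.mem_sdiff, Finset.mem_filter, Finset.mem_powersetCard, Finset.mem_image]
    refine ⟨⟨⟨hBG, by omega⟩, ?_⟩, ?_⟩
    · intro hBL
      have := (hL B hBL).2.2
      rw [this] at hB3'
      exact absurd hB3' (by decide)
    · rintro ⟨ℓ, hℓ, hℓB⟩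
      have : G \ B = ℓ := by rw [← hℓB, Finset.sdiff_sdiff_eq_self (hL ℓ hℓ).1]
      rw [this, (hL ℓ hℓ).2.2] at hge
      exact absurd hge (by decide)
  -- the four complements are distinct independent triples
  have himg : L.image (fun ℓ => G \ ℓ) ⊆ (G.powersetCard 3).filter (fun T => T ∉ L) := by
    intro T hT
    rw [Finset.mem_image] at hT
    obtain ⟨ℓ, hℓ, rfl⟩ := hT
    rw [Finset.mem_filter, Finset.mem_powersetCard]
    refine ⟨⟨Finset.sdiff_subset, by rw [Finset.card_sdiff_of_subset (hL ℓ hℓ).1, hGc, (hL ℓ hℓ).2.1]⟩, ?_⟩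
    -- `G ∖ ℓ` is not a line: it would be a line disjoint from `ℓ`, but every point is on exactly two of the four
    -- lines and two disjoint lines cover everything — contradiction with a third line meeting both in ≤ 1 point... we
    -- use the degree condition: pick `v ∈ ℓ`; the two lines through `v` are `ℓ` and another `ℓ′`; `ℓ′ ⊆ G ∖ ℓ`
    -- would contradict `v ∈ ℓ′`.  Precisely: `G ∖ ℓ ∈ L` with `v ∈ ℓ`, `v ∉ G ∖ ℓ`; the lines through `v` number `2`, the
    -- lines avoiding `v` number `2` and must be `G ∖ ℓ` and one more line `m` with `m ⊆ G ∖ {v}`, `m ≠ G ∖ ℓ`; `m` meets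
    -- `G ∖ ℓ` (a `3`-set) in ≤ 1 point so has ≥ 2 points in `ℓ ∖ {v}` (2 points): `m ⊇ ℓ ∖ {v}`, then `m ∪ ℓ` is a
    -- `4`-point set of rank ≤ 2 (two lines sharing `2` points).  We shortcut via `card_inter_le_one_of_lines`.
    intro hTL
    obtain ⟨v, hv⟩ : ∃ v, v ∈ ℓ := Finset.card_pos.1 (by rw [(hL ℓ hℓ).2.1]; norm_num)
    have hvG : v ∈ G := (hL ℓ hℓ).1 hv
    -- the lines avoiding `v`: exactly `2`, among them `G ∖ ℓ`
    have hav : (L.filter (fun m => v ∉ m)).card = 2 := by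
      have := Finset.card_filter_add_card_filter_not (s := L) (fun m => v ∈ m)
      rw [hdeg v hvG, hLc] at this
      omega
    have hmem1 : G \ ℓ ∈ L.filter (fun m => v ∉ m) := by
      rw [Finset.mem_filter]; exact ⟨hTL, fun hh => (Finset.mem_sdiff.1 hh).2 hv⟩
    obtain ⟨m, hm, hmne⟩ : ∃ m ∈ L.filter (fun m => v ∉ m), m ≠ G \ ℓ := by
      by_contra hcon
      push Not at hcon
      have : L.filter (fun m => v ∉ m) ⊆ {G \ ℓ} := fun m hm => Finset.mem_singleton.2 (hcon m hm)
      have := Finset.card_le_card this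
      rw [Finset.card_singleton] at this
      omega
    rw [Finset.mem_filter] at hm
    obtain ⟨hmL, hvm⟩ := hm
    -- `m` avoids `v` and meets the line `G ∖ ℓ` in ≤ 1 point, so it has ≥ 2 points in `ℓ`: two lines sharing 2 points
    have hGE : G ⊆ gr M := (mem_flatsQ.1 hG).1
    have hsimple := simpleOn_of_core hc hGE
    have hlong := not_hasLongLine_of_core hc hGE
    have hmℓ : m ≠ ℓ := fun hh => hvm (hh ▸ hv)
    have hi1 := card_inter_le_one_of_lines hsimple hlong hGE (hL m hmL).1 (hL ℓ hℓ).1 (hL m hmL).2.1 (hL ℓ hℓ).2.1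
      (hL m hmL).2.2 (hL ℓ hℓ).2.2 hmℓ
    have hi2 := card_inter_le_one_of_lines hsimple hlong hGE (hL m hmL).1 (hL _ hTL).1 (hL m hmL).2.1 (hL _ hTL).2.1
      (hL m hmL).2.2 (hL _ hTL).2.2 hmne
    have hsplit : m = (m ∩ ℓ) ∪ (m ∩ (G \ ℓ)) := by
      rw [← Finset.inter_union_distrib_left, Finset.union_sdiff_of_subset (hL ℓ hℓ).1,
        Finset.inter_eq_left.2 (hL m hmL).1]
    have := Finset.card_union_le (m ∩ ℓ) (m ∩ (G \ ℓ))
    rw [← hsplit, (hL m hmL).2.1] at this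
    omega
  have := Finset.card_le_card hsub
  rw [Finset.card_sdiff_of_subset himg, card_indep_triples_kFour h', Finset.card_image_of_injOn, hLc] at this
  · exact this
  · intro ℓ hℓ ℓ' hℓ' heq
    have := congrArg (fun S => G \ S) heq
    simp only [Finset.sdiff_sdiff_eq_self (hL ℓ hℓ).1, Finset.sdiff_sdiff_eq_self (hL ℓ' hℓ').1] at this
    exact this

end NightThree

end PercRepro
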